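import Summits.ResolutionOfSingularities.ResolutionOfSingularities.Theorems.FrobeniusLadderFInjectiveMacaulayficationTrFullStep
import HarnessLib

/-!
# THE «FULL ⇒ REGULAR» STEP CARRIES THE RESOLUTION SIDE: `ResolutionFullTr` from T″, the strong induction, and the door terms
# (crux `FInjectiveMacaulayfication` stmt-ResolutionOfSingularities-15315, chain w45a; object O8 (part B) of res-L1-w45a-stub-3 g9 over `TrFullStep`)

[OURS · L1 W4.5a] Support file (`--supports stmt-ResolutionOfSingularities-15315 --as helper`); replaces the role of NO printed item; NOT a statement of any
manuscript; def-free; CONDITIONAL on four published theorems BY NAME and on the chain's CANDIDATE statements. AI-written (AI review is weaker than expert review).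

* §1 ★★ `resolutionFullTr_of_cm_of_F_of_tStep (h4 : 4 ≤ e) (hG h081R hP) (hCM) (hRlt : T(p,e′,r′), 4 ≤ e′ < e, r′ ≥ 1) (hFe : F(e)) (hT : T″ p e r) : ResolutionFullTr p e r`
  — Temkin's induction on ONE FULL `e`-fold `Y/k(X₁,…,X_r)`: non-closed points by the lower T-levels and Cossart–Piltant (`DimSlice.regularOffFinite_of_rungs`), the finitely
  many bad closed points by the pointwise triple composition (`TrFullStep.exists_regularCentre_of_fullCentre_of_tStep_at` over this seat's
  `FInjectiveMacaulayficationDimFourSlice.exists_fullCentre_of_cmHalf_of_fHalf_at`) fed to `TrFullStep.admitsDesingularization_of_regularOffFinite_of_localCentre`.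
* §2 ★★ `resolutionFullTr_le_of_prints_of_F_of_tStep (n)` — STRONG INDUCTION ON THE LEVEL: {ResolutionFullTr p e r}_{4≤e≤n, r≥1} ⟸ four prints ∧ {F(e)}_{4≤e≤n} ∧
  {T″(p,e,r)}_{4≤e≤n, r≥1}; the lower T-levels come back through the square (`TrOfResolutionFull.tr_le_of_cesnaviciusOffClosed_of_F_of_resolutionFull`).
* §3 ★★★ `fInjectiveMacaulayfication_of_prints_of_LFadmF_of_tStep{,One}` — **crux ⟸ {CP 1.1, 081R, CP 4.4, Česnavičius (B)} ∧ [CM ⇒ FULL fibre-local step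
  `LocalFInjectivizationFibreAdmGe4`] ∧ [FULL ⇒ REGULAR fibre-local step `LocalRegularizationFibreFullTr p e 1`, e ≥ 4]**; and the `d = 5` slice.
[folklore assembly; cite: Temkin2008, Prop. 2.3.4, Lemma 2.1.4] [cite: StacksProject, Tag 080B] [cite: CossartPiltant2019, Thm. 1.1 (i)(ii); Prop. 4.4] [cite: Cesnavicius2021, Thm. 5.3]
[cite: RaynaudGruson1971, Thm. 5.2.2]
-/

-- single-problem summit: the doubled namespace component is forced
set_option linter.dupNamespace false

noncomputable section

namespace Summit.ResolutionOfSingularities.ResolutionOfSingularities.Theorems.FInjectiveMacaulayfication.TrFullStepDoor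

open CategoryTheory CategoryTheory.Limits AlgebraicGeometry TopologicalSpace IsLocalRing Order
open Literature.AlgebraicGeometry.Resolution
open Summit.ResolutionOfSingularities.ResolutionOfSingularities.Theorems.FInjectiveMacaulayfication
open SliceableCentre ClosedPointLocalResolutionAdmTr TrOfResolution TrOfResolutionFull ResolutionOfTr TrFull TrFullStep FTemkinClosedPoints

/-! ## §1 `ResolutionFullTr` at level `e` from the lower T-levels, the F-half at level `e` and T″ at level `e` -/

/-- ★★ **`ResolutionFullTr p e r` ⟸ {CP 1.1, 081R, CP 4.4} ∧ a CM-centre supplier ∧ the rungs T(p,e′,r′) (`4 ≤ e′ < e`, `r′ ≥ 1`) ∧ F(e) ∧ T″(p,e,r)** (`e ≥ 4`) — Temkin's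
induction on ONE FULL `e`-fold: `DimSlice.regularOffFinite_of_rungs` off the closed points, the pointwise triple composition at each bad closed point (its local ring is
FULL because `Y` is; its local dimension is `e`), `TrFullStep.admitsDesingularization_of_regularOffFinite_of_localCentre` to finish. [OURS · conditional-result]
[cite: Temkin2008, Prop. 2.3.4] [cite: CossartPiltant2019, Thm. 1.1 (i)(ii); Prop. 4.4] [cite: Cesnavicius2021, Thm. 5.3] -/
theorem resolutionFullTr_of_cm_of_F_of_tStep {p e r : ℕ} (h4 : 4 ≤ e)
    (hG : CossartPiltant2019General.{0}) (h081R : Stacks081R.{0}) (hP : CossartPiltant2019Principalization.{0})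
    (hCM : ∀ (p : ℕ), p.Prime → ∀ {k : Type} [Field k] [CharP k p] {X : Scheme.{0}} (f : X ⟶ Spec (.of k))
      [LocallyOfFiniteType f] [IsIntegral X] (x : X), ringKrullDim (X.presheaf.stalk x) ≠ 0 →
      ∀ (S' : Scheme.{0}) (g : S' ⟶ Spec (X.presheaf.stalk x)) (I : (Spec (X.presheaf.stalk x)).IdealSheafData),
        I ≠ ⊥ → IsBlowup g I → (∀ s : S', g.base s ≠ closedPoint (X.presheaf.stalk x) → s ∈ Scheme.regularLocus S') →
        ∃ 𝓚 : S'.IdealSheafData, 𝓚 ≠ ⊥ ∧ (∀ s ∈ (𝓚.support : Set S'), g.base s = closedPoint (X.presheaf.stalk x)) ∧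
          ∀ (S'' : Scheme.{0}) (π : S'' ⟶ S'), IsBlowup π 𝓚 → ∀ s : S'', IsDomain (S''.presheaf.stalk s) ∧ CMCl (S''.presheaf.stalk s))
    (hp : p.Prime)
    (hRlt : ∀ e' r' : ℕ, 4 ≤ e' → e' + 1 ≤ e → 1 ≤ r' → ClosedPointLocalResolutionAdmTr p e' r')
    (hFe : ∀ (k : Type) [Field k] [CharP k p] (X : Scheme.{0}) (f : X ⟶ Spec (.of k)),
      IsSeparated f → LocallyOfFiniteType f → QuasiCompact f → IsIntegral X →
      ∀ x : X, IsClosed ({x} : Set X) → x ∉ Scheme.regularLocus X → ringKrullDim (X.presheaf.stalk x) = e →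
      ∀ (S' : Scheme.{0}) (g : S' ⟶ Spec (X.presheaf.stalk x)) (I : (Spec (X.presheaf.stalk x)).IdealSheafData),
        I ≠ ⊥ → (I.support : Set (Spec (X.presheaf.stalk x))) ⊆ (Scheme.regularLocus (Spec (X.presheaf.stalk x)))ᶜ → IsBlowup g I →
        (∀ s : S', g.base s ≠ closedPoint (X.presheaf.stalk x) → s ∈ Scheme.regularLocus S') →
        (∀ s : S', CMCl (S'.presheaf.stalk s)) →
        ∃ 𝓚 : S'.IdealSheafData, 𝓚 ≠ ⊥ ∧ (∀ s ∈ (𝓚.support : Set S'), g.base s = closedPoint (X.presheaf.stalk x)) ∧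
          ∀ (S'' : Scheme.{0}) (π : S'' ⟶ S'), IsBlowup π 𝓚 → ∀ s : S'', FullCl p (S''.presheaf.stalk s))
    (hT : LocalRegularizationFibreFullTr p e r) : ResolutionFullTr p e r := by
  classical
  intro k _ _ Y g hs hl hq hi hd hYfull
  haveI := hs; haveI := hl; haveI := hq
  haveI := NonClosedPointChart.charP_fractionRing_mvPolynomial p k r
  obtain ⟨X', f, J, F, hf, hJ, -, hFfin, hFcl, hreg⟩ :=
    DimSlice.regularOffFinite_of_rungs hG h081R hP p _ Y g hd (by omega) hRlt
  refine admitsDesingularization_of_regularOffFinite_of_localCentre Y g (fun b hb hbs S' g' I hI hIadm hg' hregS => ?_) X' f J hf hJ hFfin.toFinset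
    (fun b hb => hFcl b (hFfin.mem_toFinset.mp hb)) (fun x' hx' => hreg x' fun h => hx' (hFfin.mem_toFinset.mpr h))
  have hbe : ringKrullDim (Y.presheaf.stalk b) = e := ringKrullDim_stalk_eq_of_isClosed g hd b hb
  refine exists_regularCentre_of_fullCentre_of_tStep_at p g b hbs ?_ ?_ S' g' I hI hIadm hg' hregS
  · -- FULL centres at `b`: the pointwise CM/F split (Česnavičius-(B) supplier ∧ F(e) at `b`)
    intro S₁ g₁ I₁ hI₁ hI₁adm hg₁ hreg₁
    exact FInjectiveMacaulayficationDimFourSlice.exists_fullCentre_of_cmHalf_of_fHalf_at p g b hbs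
      (fun S₂ g₂ I₂ hI₂ hg₂ hreg₂ => hCM p hp g b (by rw [hbe]; exact_mod_cast (show e ≠ 0 by omega)) S₂ g₂ I₂ hI₂ hg₂ hreg₂)
      (fun S₂ g₂ I₂ hI₂ hI₂adm hg₂ hreg₂ hcm₂ => hFe _ Y g hs hl hq hi b hb hbs hbe S₂ g₂ I₂ hI₂ hI₂adm hg₂ hreg₂ hcm₂)
      S₁ g₁ I₁ hI₁ hI₁adm hg₁ hreg₁
  · -- regular centres at `b` for FULL local blow-ups: T″ at the closed singular FULL point `b`
    intro S₁ g₁ I₁ hI₁ hI₁adm hg₁ hreg₁ hfull₁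
    exact hT k Y g hs hl hq hi hd b hb hbs (hYfull b) S₁ g₁ I₁ hI₁ hI₁adm hg₁ hreg₁ hfull₁

/-! ## §2 The strong induction on the level -/

/-- ★★ **{ResolutionFullTr p e r}_{4 ≤ e ≤ n, r ≥ 1} ⟸ four prints ∧ {F(e)}_{4≤e≤n} ∧ {T″(p,e,r)}_{4≤e≤n, r≥1}** — strong induction on `n`; the lower T-levels needed by §1 come
back from the lower ResolutionFull-levels through the square (`tr_le_of_cesnaviciusOffClosed_of_F_of_resolutionFull`). [OURS · conditional-result]
[cite: Temkin2008, Prop. 2.3.4; Lemma 2.1.4] [cite: CossartPiltant2019, Thm. 1.1; Prop. 4.4] [cite: Cesnavicius2021, Thm. 5.3] -/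
theorem resolutionFullTr_le_of_prints_of_F_of_tStep (n : ℕ)
    (hG : CossartPiltant2019General.{0}) (h081R : Stacks081R.{0}) (hP : CossartPiltant2019Principalization.{0})
    (hM : CesnaviciusBlowupMacaulayficationOffClosed.{0}) {p : ℕ} (hp : p.Prime)
    (hF : ∀ e : ℕ, 4 ≤ e → e ≤ n → ∀ (k : Type) [Field k] [CharP k p] (X : Scheme.{0}) (f : X ⟶ Spec (.of k)),
      IsSeparated f → LocallyOfFiniteType f → QuasiCompact f → IsIntegral X →
      ∀ x : X, IsClosed ({x} : Set X) → x ∉ Scheme.regularLocus X → ringKrullDim (X.presheaf.stalk x) = e →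
      ∀ (S' : Scheme.{0}) (g : S' ⟶ Spec (X.presheaf.stalk x)) (I : (Spec (X.presheaf.stalk x)).IdealSheafData),
        I ≠ ⊥ → (I.support : Set (Spec (X.presheaf.stalk x))) ⊆ (Scheme.regularLocus (Spec (X.presheaf.stalk x)))ᶜ → IsBlowup g I →
        (∀ s : S', g.base s ≠ closedPoint (X.presheaf.stalk x) → s ∈ Scheme.regularLocus S') →
        (∀ s : S', CMCl (S'.presheaf.stalk s)) →
        ∃ 𝓚 : S'.IdealSheafData, 𝓚 ≠ ⊥ ∧ (∀ s ∈ (𝓚.support : Set S'), g.base s = closedPoint (X.presheaf.stalk x)) ∧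
          ∀ (S'' : Scheme.{0}) (π : S'' ⟶ S'), IsBlowup π 𝓚 → ∀ s : S'', FullCl p (S''.presheaf.stalk s))
    (hT : ∀ e r : ℕ, 4 ≤ e → e ≤ n → 1 ≤ r → LocalRegularizationFibreFullTr p e r) :
    ∀ e r : ℕ, 4 ≤ e → e ≤ n → 1 ≤ r → ResolutionFullTr p e r := by
  induction n using Nat.strong_induction_on with
  | _ n ih =>
    intro e r h4 hen hr
    -- the lower T-levels `4 ≤ e′ < e` from the lower ResolutionFull-levels (square) — available by the induction hypothesis at `n := e − 1`
    have hRlt : ∀ e' r' : ℕ, 4 ≤ e' → e' + 1 ≤ e → 1 ≤ r' → ClosedPointLocalResolutionAdmTr p e' r' := by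
      intro e' r' h4' hlt hr'
      refine tr_le_of_cesnaviciusOffClosed_of_F_of_resolutionFull (e - 1) hG h081R hP hM hp (fun m hm hme => hF m hm (by omega))
        (fun m r'' hm hme hr'' => ih (e - 1) (by omega) (fun m' hm' hm'e => hF m' hm' (by omega)) (fun m' r₃ hm' hm'e hr₃ => hT m' r₃ hm' (by omega) hr₃)
          m r'' hm hme hr'') e' r' h4' (by omega) hr'
    exact resolutionFullTr_of_cm_of_F_of_tStep h4 hG h081R hP (DimSliceOfCesnavicius.cmSupplier_of_cesnaviciusOffClosed hM) hp hRlt (hF e h4 hen) (hT e r h4 hen hr)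

/-! ## §3 The door terms -/

/-- ★★★ **THE ROUTE DECL ⟸ {CP 2019 Thm 1.1, Stacks 081R, CP 2019 Prop 4.4, Česnavičius 2021 Thm 5.3 (B)} BY NAME ∧ the «CM ⇒ FULL» fibre-local step `LocalFInjectivizationFibreAdmGe4` ∧
the «FULL ⇒ REGULAR» fibre-local step {T″(p,e,r)}_{p prime, e ≥ 4, r ≥ 1}.** [OURS · conditional-result: conditional on four published theorems BY NAME and on the CANDIDATE statements]
[cite: Cesnavicius2021, Thm. 5.3] [cite: CossartPiltant2019, Thm. 1.1 (i)(ii); Prop. 4.4] [cite: Temkin2008, Prop. 2.3.4] -/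
theorem fInjectiveMacaulayfication_of_prints_of_LFadmF_of_tStep
    (hG : CossartPiltant2019General.{0}) (h081R : Stacks081R.{0}) (hP : CossartPiltant2019Principalization.{0})
    (hM : CesnaviciusBlowupMacaulayficationOffClosed.{0})
    (hLF : LocalFullificationFibreAdmGe4Split.LocalFInjectivizationFibreAdmGe4)
    (hT : ∀ p e r : ℕ, p.Prime → 4 ≤ e → 1 ≤ r → LocalRegularizationFibreFullTr p e r) :
    Summit.ResolutionOfSingularities.ResolutionOfSingularities.Theses.FrobeniusLadder.FInjectiveMacaulayfication :=
  fInjectiveMacaulayfication_of_cesnaviciusOffClosed_of_LFadmF_of_resolutionFull hG h081R hP hM hLF fun p e r hp he hr =>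
    resolutionFullTr_le_of_prints_of_F_of_tStep e hG h081R hP hM hp (fun e' h4 _ => hLF e' h4 p hp) (fun e' r' h4' _ hr' => hT p e' r' hp h4' hr') e r he le_rfl hr

/-- ★★★ **The same at ONE transcendental: crux ⟸ four prints ∧ [CM ⇒ FULL step] ∧ [FULL ⇒ REGULAR step {T″(p,e,1)}_{p prime, e ≥ 4}]** — the v41 «FULL-TO-REGULAR DOOR» `_of` term
BY NAME. [OURS · conditional-result] [cite: Cesnavicius2021, Thm. 5.3] [cite: CossartPiltant2019, Thm. 1.1 (i)(ii); Prop. 4.4] [cite: Temkin2008, Prop. 2.3.4] -/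
theorem fInjectiveMacaulayfication_of_prints_of_LFadmF_of_tStepOne
    (hG : CossartPiltant2019General.{0}) (h081R : Stacks081R.{0}) (hP : CossartPiltant2019Principalization.{0})
    (hM : CesnaviciusBlowupMacaulayficationOffClosed.{0})
    (hLF : LocalFullificationFibreAdmGe4Split.LocalFInjectivizationFibreAdmGe4)
    (hT1 : ∀ p e : ℕ, p.Prime → 4 ≤ e → LocalRegularizationFibreFullTr p e 1) :
    Summit.ResolutionOfSingularities.ResolutionOfSingularities.Theses.FrobeniusLadder.FInjectiveMacaulayfication :=
  fInjectiveMacaulayfication_of_prints_of_LFadmF_of_tStep hG h081R hP hM hLF fun p e r hp he hr => forall_tStep_of_one (hT1 p e hp he) r hr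

/-- ★ **dim ≤ 5 ⟸ four published theorems ∧ F(4) ∧ F(5) ∧ T″(p,4,1)** — on 5-folds the only resolution input of the full-to-regular door is the «FULL ⇒ REGULAR» step at
level 4 over k(s). [OURS · conditional-result] [cite: Cesnavicius2021, Thm. 5.3] [cite: CossartPiltant2019, Thm. 1.1 (i)(ii); Prop. 4.4] [cite: Temkin2008, Prop. 2.3.4] -/
theorem fInjectiveMacaulayfication_dimLe5_of_cesnaviciusOffClosed_of_tStep41_of_F45
    (hG : CossartPiltant2019General.{0}) (h081R : Stacks081R.{0}) (hP : CossartPiltant2019Principalization.{0})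
    (hM : CesnaviciusBlowupMacaulayficationOffClosed.{0})
    (hT41 : ∀ p : ℕ, p.Prime → LocalRegularizationFibreFullTr p 4 1)
    (hF4 : ∀ (p : ℕ), p.Prime → ∀ (k : Type) [Field k] [CharP k p]
    (X : Scheme.{0}) (f : X ⟶ Spec (.of k)),
      IsSeparated f → LocallyOfFiniteType f → QuasiCompact f → IsIntegral X →
      ∀ x : X, IsClosed ({x} : Set X) → x ∉ Scheme.regularLocus X → ringKrullDim (X.presheaf.stalk x) = 4 →
      ∀ (S' : Scheme.{0}) (g : S' ⟶ Spec (X.presheaf.stalk x)) (I : (Spec (X.presheaf.stalk x)).IdealSheafData),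
        I ≠ ⊥ → (I.support : Set (Spec (X.presheaf.stalk x))) ⊆ (Scheme.regularLocus (Spec (X.presheaf.stalk x)))ᶜ → IsBlowup g I →
        (∀ s : S', g.base s ≠ closedPoint (X.presheaf.stalk x) → s ∈ Scheme.regularLocus S') →
        (∀ s : S', CMCl (S'.presheaf.stalk s)) →
        ∃ 𝓚 : S'.IdealSheafData, 𝓚 ≠ ⊥ ∧ (∀ s ∈ (𝓚.support : Set S'), g.base s = closedPoint (X.presheaf.stalk x)) ∧
          ∀ (S'' : Scheme.{0}) (π : S'' ⟶ S'), IsBlowup π 𝓚 → ∀ s : S'', FullCl p (S''.presheaf.stalk s))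
    (hF5 : ∀ (p : ℕ), p.Prime → ∀ (k : Type) [Field k] [CharP k p]
    (X : Scheme.{0}) (f : X ⟶ Spec (.of k)),
      IsSeparated f → LocallyOfFiniteType f → QuasiCompact f → IsIntegral X →
      ∀ x : X, IsClosed ({x} : Set X) → x ∉ Scheme.regularLocus X → ringKrullDim (X.presheaf.stalk x) = 5 →
      ∀ (S' : Scheme.{0}) (g : S' ⟶ Spec (X.presheaf.stalk x)) (I : (Spec (X.presheaf.stalk x)).IdealSheafData),
        I ≠ ⊥ → (I.support : Set (Spec (X.presheaf.stalk x))) ⊆ (Scheme.regularLocus (Spec (X.presheaf.stalk x)))ᶜ → IsBlowup g I →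
        (∀ s : S', g.base s ≠ closedPoint (X.presheaf.stalk x) → s ∈ Scheme.regularLocus S') →
        (∀ s : S', CMCl (S'.presheaf.stalk s)) →
        ∃ 𝓚 : S'.IdealSheafData, 𝓚 ≠ ⊥ ∧ (∀ s ∈ (𝓚.support : Set S'), g.base s = closedPoint (X.presheaf.stalk x)) ∧
          ∀ (S'' : Scheme.{0}) (π : S'' ⟶ S'), IsBlowup π 𝓚 → ∀ s : S'', FullCl p (S''.presheaf.stalk s)) :
    ∀ p : ℕ, p.Prime → ∀ (k : Type) [Field k] [CharP k p] (X : Scheme.{0}) (f : X ⟶ Spec (.of k)),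
      IsSeparated f → LocallyOfFiniteType f → QuasiCompact f → IsReduced X → topologicalKrullDim X ≤ 5 →
      ∃ (X' : Scheme.{0}) (π : X' ⟶ X), IsProper π ∧ IsBirational π ∧ ∀ x : X',
        IsDomain (X'.presheaf.stalk x) ∧ ∀ d : ℕ, ringKrullDim (X'.presheaf.stalk x) = d →
          ∀ s : Fin d → X'.presheaf.stalk x, (Ideal.span (Set.range s)).radical.IsMaximal →
            RingTheory.Sequence.IsWeaklyRegular (X'.presheaf.stalk x) (List.ofFn s) ∧
            ∀ y : X'.presheaf.stalk x, (∃ e : ℕ, y ^ p ^ e ∈ Ideal.span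
              ((fun z : X'.presheaf.stalk x => z ^ p ^ e) ''
                (Ideal.span (Set.range s) : Set (X'.presheaf.stalk x)))) →
              y ∈ Ideal.span (Set.range s) :=
  fInjectiveMacaulayfication_dimLe5_of_cesnaviciusOffClosed_of_resolutionFull41_of_F45 hG h081R hP hM
    (fun p hp => resolutionFullTr_of_cm_of_F_of_tStep le_rfl hG h081R hP (DimSliceOfCesnavicius.cmSupplier_of_cesnaviciusOffClosed hM) hp
      (fun e' r' h4' hlt _ => absurd hlt (by omega)) (hF4 p hp) (hT41 p hp)) hF4 hF5

end Summit.ResolutionOfSingularities.ResolutionOfSingularities.Theorems.FInjectiveMacaulayfication.TrFullStepDoor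

end
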